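import Literature.Analysis.FluidPDE.FractionalNSStartingTripleBounds
import Literature.Analysis.FluidPDE.FractionalNSPrescribedEnergyIterationSums
import HarnessLib

/-!
# Colombo–De Lellis–De Rosa 2018, Prop. 3.2 from Lemma 3.1 and the inductive step (§8.2–8.3)

Analysis/FluidPDE file. The named fact `ColomboDeLellisDeRosa2018_prop32`
(`FractionalNSPrescribedEnergyIteration`) — the convex-integration iteration of Colombo–De Lellis–
De Rosa, *Ill-posedness of Leray solutions for the hypodissipative Navier–Stokes equations*,
Comm. Math. Phys. 362 (2018) = arXiv:1708.05666, Prop. 3.2 run universally over a family of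
profiles (§8.3) — is proved in the source (§8.2, "The proposition is proved inductively. The
initial triple is defined to be the triple `(v₀, p₀, R̊₀)` derived in Lemma 3.1 … Given now
`(v_q, p_q, R̊_q)` satisfying the estimates (27)–(33), we claim that the triple
`(v_{q+1}, p_{q+1}, R̊_{q+1})` constructed above satisfies again all the corresponding estimates")
from two ingredients:

1. **Lemma 3.1** (the starting triple) — PROVED in the tree
   (`ColomboDeLellisDeRosa2018_lem31`, `FractionalNSStartingTripleBounds`);
2. **the inductive step** — the construction of §4 (mollification, time discretisation and
   transport of the stress, Beltrami perturbation `w = w_o + w_c`, the operator `ℛ`, the new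
   stress (58) and pressure (59)) together with the estimates of §§5–8.2 showing that the working
   hypotheses (44)–(47), (35) at stage `q` produce (26)–(33), (35) at stage `q + 1`, and with the
   locality at `t = 0` used in §8.3 ("each `v_{e,q+1}(·,0)` and `R̊_{e,q+1}(·,0)` depend only upon
   the `v_{q,e}(·,0)`, `R̊_{q,e}(·,0)` and `e(0)`"). This is the research-level core of the paper
   and is NOT proved here: it enters the main theorem of this file as an explicit HYPOTHESIS,
   the predicate `CDLDR.StepSpec` (a definition with parameters, describing the one-step map and
   its estimates; no closed statement about it is asserted in this file).

Main result: `ColomboDeLellisDeRosa2018_prop32_of_stepSpec` — if for every `α ∈ (0, 1/5)` the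
inductive step holds in some normalisation window (`∃ c₀ ≤ 1, T₀, M ≥ 1, η, C₁` with
`CDLDR.StepSpec α c₀ T₀ M η C₁`), then `ColomboDeLellisDeRosa2018_prop32` holds. The proof is the
induction of §8.2 with the bookkeeping (43) (`FractionalNSPrescribedEnergyIterationSums`:
`∑_{j=1}^{q} δ_j^{1/2} ≤ ½`, `∑_{j≤q} δ_j^{1/2}λ_j ≤ 2δ_q^{1/2}λ_q`, `∑_{j≤q} δ_jλ_j ≤ 2δ_qλ_q`, which turn the
increment bounds (27)–(30) into the working hypotheses (44), (46)), the starting triple of Lemma 3.1 with the universal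
frequency (82), the integer frequencies (34) (`CDLDR.exists_freq`), and the common initial slices
(Lemma 3.1's slices depend only on `e(0)`, `e'(0)`; the step is local at `t = 0`).

## Contents

* `CDLDR.IsStage` — the working hypotheses of the inductive step at stage `q` ((26), (44)–(47),
  (35));
* `CDLDR.IsStepOutput` — what the step delivers at stage `q + 1` ((26); the increments (27)–(30);
  (31)–(33) and (35) at `q + 1`);
* `CDLDR.StepSpec α c₀ T₀ M η C₁` — the inductive step as a hypothesis predicate: quantifier
  structure of Prop. 3.2/§8.2 (`∀ c > 5/2 ∃ b₁ > 1 ∀ b ∈ (1,b₁) ∃ a₀ ∀ a ≥ a₀`, frequencies (34)),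
  one-step maps `Φ = (Φv, Φp, ΦR)` acting on `(e, q, v_q, p_q, R̊_q)`, the estimates, the
  condition (55) `a ≥ C‖e'‖₀` (as `a ≥ C₁E₁`), and the locality at `t = 0`;
* `ColomboDeLellisDeRosa2018_prop32_of_stepSpec` — the assembly.

## References

* M. Colombo, C. De Lellis, L. De Rosa, Comm. Math. Phys. 362 (2018) = arXiv:1708.05666: §3
  (26)–(35), Lemma 3.1, Prop. 3.2 (41); §4 (43)–(47), (58)–(59); §8.1 (52)–(54); §8.2 (proof of
  Prop. 3.2, incl. (55)–(56)); §8.3 (81)–(82) and the locality paragraph (p. 19).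
  [`ColomboDelellisDerosa2018`]
-/

noncomputable section

open MeasureTheory Set Filter Function UnitAddTorus
open scoped ENNReal NNReal InnerProductSpace ContDiff

namespace Literature.Analysis.FluidPDE

namespace CDLDR

open FunctionSpaces PulsedShear

/-- The flat three-torus `𝕋³ = (ℝ/ℤ)³`, local notation. -/
local notation "𝕋³" => UnitAddTorus (Fin 3)

/-- Euclidean `ℝ³`, local notation. -/
local notation "ℝ³" => EuclideanSpace ℝ (Fin 3)

/-! ## The working hypotheses and the output of the inductive step -/

section Step

/-- Velocity fields on `[0,T₀] × 𝕋³` (curried in time). [folklore] -/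
abbrev VelField : Type := ℝ → 𝕋³ → ℝ³

/-- Pressure fields on `[0,T₀] × 𝕋³`. [folklore] -/
abbrev PresField : Type := ℝ → 𝕋³ → ℝ

/-- Stress fields on `[0,T₀] × 𝕋³`, stored by columns. [folklore] -/
abbrev StressField : Type := ℝ → 𝕋³ → Fin 3 → ℝ³

/-- **The working hypotheses of the inductive step at stage `q`** (Colombo–De Lellis–De Rosa
2018, §4 (44)–(47) with (26) and (35): "Our inductive hypothesis together with Lemma 3.1 imply
then the following set of estimates"): the triple solves the fractional Navier–Stokes–Reynolds
system on `[0,T₀] × 𝕋³` with a trace-free (symmetric) stress, and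
(44) `‖v_q‖₀ ≤ 2M`, `[v_q]₁ ≤ 2Mδ_q^{1/2}λ_q`; (45) `‖R̊_q‖₀ ≤ ηδ_{q+1}`, `[R̊_q]₁ ≤ Mδ_{q+1}λ_q`;
(46) `‖p_q‖₀ ≤ 2M²`, `[p_q]₁ ≤ 2M²δ_qλ_q` (used through Lemma 5.2, `‖D_t v_ℓ‖_N ≲ δ_qλ_qℓ^{-N}`,
taken from BDIS); (47) `‖(∂ₜ + v_q·∇)R̊_q‖₀ ≤ Mδ_{q+1}δ_q^{1/2}λ_q`;
(35) `|e(t)(1-δ_{q+1}) - ∫|v_q|²| ≤ ¼δ_{q+1}e(t)` (`δ = CDLDR.amp a b`, `λ_q = Λ q`).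
[cite: ColomboDelellisDerosa2018, §4 (44)–(47), §3 (26), (35)] -/
structure IsStage (α T₀ M η a b : ℝ) (Λ : ℕ → ℕ) (e : ℝ → ℝ) (q : ℕ)
    (v : VelField) (p : PresField) (R : StressField) : Prop where
  /-- (26): the triple solves the fractional Navier–Stokes–Reynolds system on `[0,T₀] × 𝕋³`. -/
  solves : Torus.IsFracNSReynoldsOn (Icc 0 T₀) α 1 v p R
  /-- The stress is trace free. -/
  traceFree : ∀ t ∈ Icc 0 T₀, ∀ x, ∑ i, R t x i i = 0
  /-- (44): `‖v_q‖₀ ≤ 2M`. -/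
  velocity_sup : BDSV.SupLE T₀ v (2 * M)
  /-- (44): `[v_q]₁ ≤ 2Mδ_q^{1/2}λ_q`. -/
  velocity_deriv : BDSV.DerivSupLE T₀ v (2 * M * Real.sqrt (amp a b q) * Λ q)
  /-- (45): `‖R̊_q‖₀ ≤ ηδ_{q+1}`. -/
  stress_sup : BDSV.SupLE T₀ R (η * amp a b (q + 1))
  /-- (45): `[R̊_q]₁ ≤ Mδ_{q+1}λ_q`. -/
  stress_deriv : BDSV.DerivSupLE T₀ R (M * amp a b (q + 1) * Λ q)
  /-- (46): `‖p_q‖₀ ≤ 2M²`. -/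
  pressure_sup : BDSV.SupLE T₀ p (2 * M ^ 2)
  /-- (46): `[p_q]₁ ≤ 2M²δ_qλ_q`. -/
  pressure_deriv : BDSV.DerivSupLE T₀ p (2 * M ^ 2 * amp a b q * Λ q)
  /-- (47): `‖(∂ₜ + v_q·∇)R̊_q‖₀ ≤ Mδ_{q+1}δ_q^{1/2}λ_q`. -/
  transport : ∀ t ∈ Icc 0 T₀, ∀ x,
    ‖FunctionSpaces.Torus.timeDerivWithin (Icc 0 T₀) R t x + FunctionSpaces.Torus.convect (v t) (R t) x‖ ≤
      M * amp a b (q + 1) * Real.sqrt (amp a b q) * Λ q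
  /-- (35): `|e(t)(1 - δ_{q+1}) - ∫|v_q(t)|²| ≤ ¼δ_{q+1}e(t)` on `[0,T₀]`. -/
  energy : ∀ t ∈ Icc 0 T₀, |e t * (1 - amp a b (q + 1)) - ∫ x, ‖v t x‖ ^ 2| ≤ 1 / 4 * amp a b (q + 1) * e t

/-- **The output of the inductive step at stage `q + 1`** (Colombo–De Lellis–De Rosa 2018, §8.2,
"we claim that the triple `(v_{q+1}, p_{q+1}, R̊_{q+1})` constructed above satisfies again all the
corresponding estimates"): (26) with a trace-free stress ("`R̊_{q+1}` is indeed a traceless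
symmetric tensor"); the increments (27) `‖v_{q+1} - v_q‖₀ ≤ Mδ_{q+1}^{1/2}`,
(28) `[v_{q+1} - v_q]₁ ≤ Mδ_{q+1}^{1/2}λ_{q+1}`, (29) `‖p_{q+1} - p_q‖₀ ≤ M²δ_{q+1}`,
(30) `[p_{q+1} - p_q]₁ ≤ M²δ_{q+1}λ_{q+1}`; and at stage
`q + 1`: (31) `‖R̊_{q+1}‖₀ ≤ ηδ_{q+2}`, (32) `[R̊_{q+1}]₁ ≤ Mδ_{q+2}λ_{q+1}`,
(33) `‖(∂ₜ + v_{q+1}·∇)R̊_{q+1}‖₀ ≤ δ_{q+2}δ_{q+1}^{1/2}λ_{q+1}`,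
(35) `|e(t)(1-δ_{q+2}) - ∫|v_{q+1}|²| ≤ ¼δ_{q+2}e(t)`.
[cite: ColomboDelellisDerosa2018, §3 (26)–(33), (35); §8.2 ("Estimates on `R̊_{q+1}`", "on `v_{q+1}-v_q`", "on the energy", "on `p_{q+1}-p_q`")] -/
structure IsStepOutput (α T₀ M η a b : ℝ) (Λ : ℕ → ℕ) (e : ℝ → ℝ) (q : ℕ)
    (v : VelField) (p : PresField) (v' : VelField) (p' : PresField) (R' : StressField) : Prop where
  /-- (26) at stage `q + 1`. -/
  solves : Torus.IsFracNSReynoldsOn (Icc 0 T₀) α 1 v' p' R'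
  /-- The new stress is trace free. -/
  traceFree : ∀ t ∈ Icc 0 T₀, ∀ x, ∑ i, R' t x i i = 0
  /-- (27): `‖v_{q+1} - v_q‖₀ ≤ Mδ_{q+1}^{1/2}`. -/
  incr_sup : BDSV.SupLE T₀ (fun t x => v' t x - v t x) (M * Real.sqrt (amp a b (q + 1)))
  /-- (28): `[v_{q+1} - v_q]₁ ≤ Mδ_{q+1}^{1/2}λ_{q+1}`. -/
  incr_deriv : BDSV.DerivSupLE T₀ (fun t x => v' t x - v t x) (M * Real.sqrt (amp a b (q + 1)) * Λ (q + 1))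
  /-- (29): `‖p_{q+1} - p_q‖₀ ≤ M²δ_{q+1}`. -/
  pressure_incr_sup : BDSV.SupLE T₀ (fun t x => p' t x - p t x) (M ^ 2 * amp a b (q + 1))
  /-- (30): `[p_{q+1} - p_q]₁ ≤ M²δ_{q+1}λ_{q+1}`. -/
  pressure_incr_deriv : BDSV.DerivSupLE T₀ (fun t x => p' t x - p t x) (M ^ 2 * amp a b (q + 1) * Λ (q + 1))
  /-- (31) at stage `q + 1`: `‖R̊_{q+1}‖₀ ≤ ηδ_{q+2}`. -/
  stress_sup : BDSV.SupLE T₀ R' (η * amp a b (q + 2))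
  /-- (32) at stage `q + 1`: `[R̊_{q+1}]₁ ≤ Mδ_{q+2}λ_{q+1}`. -/
  stress_deriv : BDSV.DerivSupLE T₀ R' (M * amp a b (q + 2) * Λ (q + 1))
  /-- (33) at stage `q + 1`: `‖(∂ₜ + v_{q+1}·∇)R̊_{q+1}‖₀ ≤ δ_{q+2}δ_{q+1}^{1/2}λ_{q+1}`. -/
  transport : ∀ t ∈ Icc 0 T₀, ∀ x,
    ‖FunctionSpaces.Torus.timeDerivWithin (Icc 0 T₀) R' t x + FunctionSpaces.Torus.convect (v' t) (R' t) x‖ ≤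
      amp a b (q + 2) * Real.sqrt (amp a b (q + 1)) * Λ (q + 1)
  /-- (35) at stage `q + 1`. -/
  energy : ∀ t ∈ Icc 0 T₀, |e t * (1 - amp a b (q + 2)) - ∫ x, ‖v' t x‖ ^ 2| ≤ 1 / 4 * amp a b (q + 2) * e t

/-- **The inductive step of the Colombo–De Lellis–De Rosa scheme, as a hypothesis predicate**
(the content of §4 and §§5–8.2 of the source, with the locality of §8.3; NOT proved in the tree).
For the exponent `α`, a normalisation window `[0,T₀]`, `c₀/2 ≤ e ≤ c₀`, and constants `M, η`
(§4.5: "`M` and `η` … fixed geometric constants") and `C₁` ((55)–(56): "`a ≥ C‖e'‖₀` is certainly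
sufficient"), it says: for every `c > 5/2` there is `b₁ > 1` (§8.2: "choosing `b` sufficiently
near `1`") such that for `1 < b < b₁` there is `a₀ > 1` (Prop. 3.2: `a₀(b,c)`) such that for all
`a ≥ a₀` and all integer frequencies `λ_q ∈ [a^{cb^{q+1}}, 2a^{cb^{q+1}}]` (34) there are one-step
maps `(e, q, v_q, p_q, R̊_q) ↦ (v_{q+1}, p_{q+1}, R̊_{q+1}) = (Φv, Φp, ΦR)(e, q, v_q, p_q, R̊_q)`
(the construction of §4) which (a) send every stage satisfying the working hypotheses
(`IsStage`, for a profile `e` with `IsEnergyProfile c₀ T₀ E₁ e`, `E₁ ≥ 1`, `a ≥ C₁E₁`) to a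
triple satisfying `IsStepOutput` (§8.2), and (b) are local at `t = 0`: the time-`0` slices of
`v_{q+1}` and `R̊_{q+1}` only depend on those of `v_q`, `R̊_q` and on `e(0)` (§8.3, p. 19: "it is
straightforward to conclude that each `v_{e,q+1}(·,0)` and `R̊_{e,q+1}(·,0)` depend only upon the
`v_{q,e}(·,0)`, `R̊_{q,e}(·,0)` and `e(0)`" — true for the construction since the `ρ_l` are
constant in time, the stresses `R̊_{ℓ,l}` and phases `Φ_l` are transported from `t = l/μ`, and
`χ₀ ≡ 1` near `t = 0`). [cite: ColomboDelellisDerosa2018, §3.2 Prop. 3.2; §4; §8.2; §8.3 (p. 19)] -/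
structure StepSpec (α c₀ T₀ M η C₁ : ℝ) : Prop where
  /-- The one-step construction with its estimates and its locality at `t = 0`. -/
  spec : ∀ c : ℝ, 5 / 2 < c → ∃ b₁ : ℝ, 1 < b₁ ∧ ∀ b : ℝ, 1 < b → b < b₁ → ∃ a₀ : ℝ, 1 < a₀ ∧
    ∀ (a : ℝ) (Λ : ℕ → ℕ), a₀ ≤ a →
      (∀ q, a ^ (c * b ^ (q + 1)) ≤ Λ q ∧ (Λ q : ℝ) ≤ 2 * a ^ (c * b ^ (q + 1))) →
      ∃ (Φv : (ℝ → ℝ) → ℕ → VelField → PresField → StressField → VelField)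
        (Φp : (ℝ → ℝ) → ℕ → VelField → PresField → StressField → PresField)
        (ΦR : (ℝ → ℝ) → ℕ → VelField → PresField → StressField → StressField),
        (∀ (E₁ : ℝ) (e : ℝ → ℝ) (q : ℕ) (v : VelField) (p : PresField) (R : StressField),
            1 ≤ E₁ → C₁ * E₁ ≤ a → IsEnergyProfile c₀ T₀ E₁ e → IsStage α T₀ M η a b Λ e q v p R →
            IsStepOutput α T₀ M η a b Λ e q v p (Φv e q v p R) (Φp e q v p R) (ΦR e q v p R)) ∧
        (∀ (E₁ E₁' : ℝ) (e₁ e₂ : ℝ → ℝ) (q : ℕ) (v₁ : VelField) (p₁ : PresField) (R₁ : StressField)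
            (v₂ : VelField) (p₂ : PresField) (R₂ : StressField),
            1 ≤ E₁ → C₁ * E₁ ≤ a → IsEnergyProfile c₀ T₀ E₁ e₁ → IsStage α T₀ M η a b Λ e₁ q v₁ p₁ R₁ →
            1 ≤ E₁' → C₁ * E₁' ≤ a → IsEnergyProfile c₀ T₀ E₁' e₂ → IsStage α T₀ M η a b Λ e₂ q v₂ p₂ R₂ →
            e₁ 0 = e₂ 0 → v₁ 0 = v₂ 0 → R₁ 0 = R₂ 0 →
            Φv e₁ q v₁ p₁ R₁ 0 = Φv e₂ q v₂ p₂ R₂ 0 ∧ ΦR e₁ q v₁ p₁ R₁ 0 = ΦR e₂ q v₂ p₂ R₂ 0)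

end Step

/-! ## Complements on the starting triple -/

section Start

variable {α : ℝ} {n : ℕ} {e e₁ e₂ : ℝ → ℝ} {δ c₀ : ℝ}

/-- `δ ≤ δ^{1/2}` for `0 ≤ δ ≤ 1`. [folklore] -/
theorem amp_le_sqrt_amp {x : ℝ} (h0 : 0 ≤ x) (h1 : x ≤ 1) : x ≤ Real.sqrt x := by
  calc x = Real.sqrt x * Real.sqrt x := (Real.mul_self_sqrt h0).symm
    _ ≤ Real.sqrt x * 1 := mul_le_mul_of_nonneg_left (Real.sqrt_le_one.mpr h1 |>.trans_eq' rfl) (Real.sqrt_nonneg x)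
    _ = Real.sqrt x := mul_one _

/-- The starting stress is trace free. [folklore] -/
theorem shearStress_diag (α : ℝ) (n : ℕ) (g : ℝ → ℝ) (t : ℝ) (x : 𝕋³) (i : Fin 3) :
    shearStress α n g t x i i = 0 := by
  rw [shearStress_apply, Pi.smul_apply, PiLp.smul_apply, stressProfile_diag, smul_zero]

/-- The starting stress at time `0` only depends on `e(0)` and `e'(0)`: profiles with common
value and slope at `0` (both above `c₀/4` there, `δ < 1`) give a common initial slice of `R̊₀`
("the velocity `v_{e,0}` and the Reynolds stress `R̊_{e,0}` have the same initial value", §8.3).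
[cite: ColomboDelellisDerosa2018, §8.3 (p. 19)] -/
theorem shearStress_startAmp_zero_eq (he₁ : Differentiable ℝ e₁) (he₂ : Differentiable ℝ e₂)
    (hδ : δ < 1) (hc₀ : 0 ≤ c₀) (h₁ : c₀ / 4 < e₁ 0) (h0 : e₁ 0 = e₂ 0) (h1 : deriv e₁ 0 = deriv e₂ 0)
    (α : ℝ) (n : ℕ) :
    shearStress α n (startAmp e₁ δ) 0 = shearStress α n (startAmp e₂ δ) 0 := by
  have h₂ : c₀ / 4 < e₂ 0 := h0 ▸ h₁
  have hg : startAmp e₁ δ 0 = startAmp e₂ δ 0 := by simp [startAmp_def, h0]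
  have hg' : deriv (startAmp e₁ δ) 0 = deriv (startAmp e₂ δ) 0 := by
    rw [deriv_startAmp_eq he₁ hδ hc₀ (show (0:ℝ) ∈ e₁ ⁻¹' Ioi (c₀ / 4) from h₁),
      deriv_startAmp_eq he₂ hδ hc₀ (show (0:ℝ) ∈ e₂ ⁻¹' Ioi (c₀ / 4) from h₂), h1, hg]
  funext x j
  rw [shearStress_apply, shearStress_apply, shearCoef, shearCoef, hg, hg']

end Start

/-! ## The assembly -/

section Assembly
set_option maxHeartbeats 400000 in -- buildfix (bf3-g26): 160k/180k FAIL, 200k PASS at accept time; line-neutral budget line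
/-- **Colombo–De Lellis–De Rosa 2018, Prop. 3.2 (universal form of §8.3) from Lemma 3.1 and the
inductive step** — the induction of §8.2: "The proposition is proved inductively. The initial
triple is defined to be the triple `(v₀, p₀, R̊₀)` derived in Lemma 3.1 (observe that, since
`(c-1)b - 1/2 > 1`, (41) is stronger than (36)). Given now `(v_q, p_q, R̊_q)` satisfying the
estimates (27)–(33), we claim that the triple `(v_{q+1}, p_{q+1}, R̊_{q+1})` constructed above
satisfies again all the corresponding estimates", together with §8.3 (universal parameters (81),
common frequency (82), common initial slices). GIVEN the inductive step (`CDLDR.StepSpec`, a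
hypothesis: the construction of §4 with the estimates of §§5–8.2), everything else is proved:
Lemma 3.1 (`ColomboDeLellisDeRosa2018_lem31`), the sums (43)
(`CDLDR.sum_sqrt_amp_succ_le`, `CDLDR.sum_sqrt_amp_mul_le`) turning the increments (27)–(28)
into the working hypotheses (44), the integer frequencies (34) (`CDLDR.exists_freq`), and the
propagation of the common time-`0` slices.
[cite: ColomboDelellisDerosa2018, §8.2 (proof of Prop. 3.2) and §8.3 (proof of Prop. 2.2, p. 19)] -/
theorem _root_.Literature.Analysis.FluidPDE.ColomboDeLellisDeRosa2018_prop32_of_stepSpec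
    (hstep : ∀ α : ℝ, 0 < α → α < 1 / 5 → ∃ c₀ T₀ M η C₁ : ℝ,
      0 < c₀ ∧ c₀ ≤ 1 ∧ 0 < T₀ ∧ 1 ≤ M ∧ 0 < η ∧ 0 ≤ C₁ ∧ StepSpec α c₀ T₀ M η C₁) :
    ColomboDeLellisDeRosa2018_prop32 := by
  intro α hα hα5
  obtain ⟨c₀, T₀, M, η, C₁, hc₀, hc₀1, hT₀, hM, hη, hC₁, hS⟩ := hstep α hα hα5
  have hM0 : 0 < M := by linarith
  -- the constant `C₀` of Prop. 3.2: the maximum of Lemma 3.1's and the step's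
  set CL : ℝ := startDerivConst α c₀ T₀ M η with hCL_def
  have hCL1 : 1 ≤ CL := one_le_startDerivConst hT₀ hM0 hη
  set C₀ : ℝ := max CL C₁ with hC₀_def
  have hC₀1 : 1 ≤ C₀ := hCL1.trans (le_max_left _ _)
  refine ⟨c₀, T₀, M, η, C₀, hc₀, hT₀, hM, hη, hC₀1, fun c hc => ?_⟩
  obtain ⟨b₁, hb₁, hSb⟩ := hS.spec c hc
  refine ⟨b₁, hb₁, fun b hb hbb₁ => ?_⟩
  obtain ⟨a₀, ha₀, hSa⟩ := hSb b hb hbb₁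
  -- the threshold `a₀` of Prop. 3.2: the step's, Lemma 3.1's, and the bookkeeping threshold
  set A₀ : ℝ := max (max a₀ (startThreshold α c₀ T₀ M η)) ((9 : ℝ) ^ (1 / (b - 1))) with hA₀_def
  have hA₀1 : 1 < A₀ := ha₀.trans_le ((le_max_left _ _).trans (le_max_left _ _))
  refine ⟨A₀, hA₀1, fun E₁ E₂ a 𝓔 hE₁ hE₁₂ haA hCE₁ hCE₂ h𝓔 => ?_⟩
  have ha₀a : a₀ ≤ a := ((le_max_left _ _).trans (le_max_left _ _)).trans haA
  have hthr : startThreshold α c₀ T₀ M η ≤ a := ((le_max_right _ _).trans (le_max_left _ _)).trans haA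
  have h9 : (9 : ℝ) ^ (1 / (b - 1)) ≤ a := (le_max_right _ _).trans haA
  have ha1 : 1 ≤ a := ha₀.le.trans ha₀a
  have ha0 : 0 < a := by linarith
  have hE₁1 : 1 ≤ E₁ := hE₁.le
  have hE₂0 : 0 ≤ E₂ := by linarith
  -- the integer frequencies (34) and the step maps
  obtain ⟨Λ, hΛ⟩ := exists_freq ha1 (by linarith : (0:ℝ) ≤ b) (by linarith : (0:ℝ) ≤ c)
  obtain ⟨Φv, Φp, ΦR, hout, hloc⟩ := hSa a Λ ha₀a hΛ
  -- the hypotheses of Lemma 3.1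
  have hCLE₁ : CL * E₁ ≤ a := (mul_le_mul_of_nonneg_right (le_max_left _ _) (by linarith)).trans hCE₁
  have hC₁E₁ : C₁ * E₁ ≤ a := (mul_le_mul_of_nonneg_right (le_max_right _ _) (by linarith)).trans hCE₁
  have hCLE₂ : CL * E₂ ^ (1 / ((2 * c - 1) * b - 1)) ≤ a :=
    (mul_le_mul_of_nonneg_right (le_max_left _ _) (Real.rpow_nonneg hE₂0 _)).trans hCE₂
  have H : StartHyp α c₀ T₀ M η a b c E₁ E₂ :=
    { α_pos := hα, α_lt := hα5, c₀_pos := hc₀, c₀_le_one := hc₀1, T₀_pos := hT₀, one_le_M := hM,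
      η_pos := hη, c_ge := hc.le, b_ge := hb.le, one_le_E₁ := hE₁1, one_le_E₂ := hE₁1.trans hE₁₂,
      threshold_le := hthr, E₁_le := hCLE₁, E₂_le := hCLE₂ }
  have hlam : a ^ (c * b) ≤ Λ 0 := by simpa using (hΛ 0).1
  -- amplitudes
  have hamp0 : ∀ q, 0 < amp a b q := fun q => amp_pos ha0 b q
  have hamp1 : ∀ q, amp a b q ≤ 1 := fun q => amp_le_one ha1 (by linarith) q
  have hamp1lt : amp a b 1 < 1 := by
    rw [amp_def, pow_one]
    exact Real.rpow_lt_one_of_one_lt_of_neg (by linarith) (by linarith)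
  have hΛ0 : ∀ q, (0 : ℝ) ≤ Λ q := fun q => Nat.cast_nonneg _
  -- the sequences: start with Lemma 3.1's triple and iterate the step maps
  set n : ℕ := startFreq α c₀ T₀ η a b c E₁ E₂ with hn_def
  set start : (ℝ → ℝ) → VelField × PresField × StressField := fun e =>
    (shearVelocity n (startAmp e (amp a b 1)), fun _ _ => 0, shearStress α n (startAmp e (amp a b 1)))
    with hstart_def
  set S : (ℝ → ℝ) → ℕ → VelField × PresField × StressField := fun e q =>
    Nat.rec (start e) (fun q s => (Φv e q s.1 s.2.1 s.2.2, Φp e q s.1 s.2.1 s.2.2, ΦR e q s.1 s.2.1 s.2.2)) q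
    with hS_def
  have hS0 : ∀ e, S e 0 = start e := fun e => rfl
  have hS1 : ∀ e q, S e (q + 1) =
      (Φv e q (S e q).1 (S e q).2.1 (S e q).2.2, Φp e q (S e q).1 (S e q).2.1 (S e q).2.2,
        ΦR e q (S e q).1 (S e q).2.1 (S e q).2.2) := fun e q => rfl
  -- the main induction: the working hypotheses together with the cumulative bounds on `v_q`
  have key : ∀ e ∈ 𝓔, ∀ q,
      IsStage α T₀ M η a b Λ e q (S e q).1 (S e q).2.1 (S e q).2.2 ∧
      BDSV.SupLE T₀ (S e q).1 (M * (1 + ∑ j ∈ Finset.range q, Real.sqrt (amp a b (j + 1)))) ∧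
      BDSV.DerivSupLE T₀ (S e q).1 (M * ∑ j ∈ Finset.range (q + 1), Real.sqrt (amp a b j) * Λ j) ∧
      BDSV.SupLE T₀ (S e q).2.1 (M ^ 2 * ∑ j ∈ Finset.range q, amp a b (j + 1)) ∧
      BDSV.DerivSupLE T₀ (S e q).2.1 (M ^ 2 * ∑ j ∈ Finset.range q, amp a b (j + 1) * Λ (j + 1)) := by
    intro e he
    have P : StartProfile c₀ T₀ E₁ E₂ e := h𝓔.startProfile he
    have Pe : IsEnergyProfile c₀ T₀ E₁ e := h𝓔.isEnergyProfile he
    obtain ⟨hn1, L26, L31, L32, L33, L37, L38a, L38b, L35⟩ := ColomboDeLellisDeRosa2018_lem31 H hlam P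
    intro q
    induction q with
    | zero =>
      have hp0 : (S e 0).2.1 = fun _ _ => (0 : ℝ) := rfl
      refine ⟨?_, ?_, ?_, ?_, ?_⟩
      · refine ⟨L26, fun t _ x => ?_, ?_, ?_, L31, ?_, ?_, ?_, fun t ht x => ?_, fun t ht => ?_⟩
        · simp only [hS0, hstart_def]
          exact Finset.sum_eq_zero fun i _ => shearStress_diag α n _ t x i
        · exact fun t ht x => (L37 t ht x).trans (by linarith)
        · intro i t ht x
          refine (L38b i t ht x).trans ?_
          have : 0 ≤ M * Real.sqrt (amp a b 0) * Λ 0 :=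
            mul_nonneg (mul_nonneg hM0.le (Real.sqrt_nonneg _)) (hΛ0 0)
          linarith
        · exact L32
        · rw [hp0]
          exact (BDSV.supLE_zero T₀).mono (by positivity)
        · rw [hp0]
          exact (BDSV.derivSupLE_zero T₀).mono
            (mul_nonneg (mul_nonneg (by positivity) (hamp0 0).le) (hΛ0 0))
        · refine (L33 t ht x).trans ?_
          have h0 : 0 ≤ amp a b 1 * Real.sqrt (amp a b 0) * Λ 0 :=
            mul_nonneg (mul_nonneg (hamp0 1).le (Real.sqrt_nonneg _)) (hΛ0 0)
          calc amp a b 1 * Real.sqrt (amp a b 0) * Λ 0 = 1 * (amp a b 1 * Real.sqrt (amp a b 0) * Λ 0) := (one_mul _).symm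
            _ ≤ M * (amp a b 1 * Real.sqrt (amp a b 0) * Λ 0) := mul_le_mul_of_nonneg_right hM h0
            _ = M * amp a b (0 + 1) * Real.sqrt (amp a b 0) * Λ 0 := by ring
        · have h := L35 t ht
          have het : 0 ≤ e t := by linarith [P.lower t ht]
          change |e t * (1 - amp a b 1) - ∫ x, ‖shearVelocity n (startAmp e (amp a b 1)) t x‖ ^ 2| ≤
            1 / 4 * amp a b 1 * e t
          rw [h, mul_comm (e t), sub_self, abs_zero]
          exact mul_nonneg (mul_nonneg (by norm_num) (hamp0 1).le) het
      · intro t ht x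
        rw [Finset.sum_range_zero, add_zero, mul_one]
        exact L37 t ht x
      · intro i t ht x
        rw [Finset.sum_range_one, ← mul_assoc]
        exact L38b i t ht x
      · rw [hp0, Finset.sum_range_zero, mul_zero]
        exact BDSV.supLE_zero T₀
      · rw [hp0, Finset.sum_range_zero, mul_zero]
        exact BDSV.derivSupLE_zero T₀
    | succ q ih =>
      obtain ⟨hSt, hsup, hder, hpsup, hpder⟩ := ih
      have O := hout E₁ e q (S e q).1 (S e q).2.1 (S e q).2.2 hE₁1 hC₁E₁ Pe hSt
      -- cumulative sup bound
      have hsup' : BDSV.SupLE T₀ (S e (q + 1)).1 (M * (1 + ∑ j ∈ Finset.range (q + 1), Real.sqrt (amp a b (j + 1)))) := by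
        intro t ht x
        rw [hS1]
        calc ‖Φv e q (S e q).1 (S e q).2.1 (S e q).2.2 t x‖
            ≤ ‖(S e q).1 t x‖ + ‖Φv e q (S e q).1 (S e q).2.1 (S e q).2.2 t x - (S e q).1 t x‖ := norm_le_insert' _ _
          _ ≤ M * (1 + ∑ j ∈ Finset.range q, Real.sqrt (amp a b (j + 1))) + M * Real.sqrt (amp a b (q + 1)) :=
              add_le_add (hsup t ht x) (O.incr_sup t ht x)
          _ = M * (1 + ∑ j ∈ Finset.range (q + 1), Real.sqrt (amp a b (j + 1))) := by
              rw [Finset.sum_range_succ]; ring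
      -- cumulative derivative bound
      have hder' : BDSV.DerivSupLE T₀ (S e (q + 1)).1 (M * ∑ j ∈ Finset.range (q + 1 + 1), Real.sqrt (amp a b j) * Λ j) := by
        intro i t ht x
        rw [hS1]
        dsimp only
        set v := (S e q).1 with hv_def
        set v' := Φv e q v (S e q).2.1 (S e q).2.2 with hv'_def
        have hvt : FunctionSpaces.Torus.IsContDiff 1 (v t) :=
          (hSt.solves.smooth_velocity.isSmooth_slice ht).isContDiff (by simp)
        have hv't : FunctionSpaces.Torus.IsContDiff 1 (v' t) :=
          (O.solves.smooth_velocity.isSmooth_slice ht).isContDiff (by simp)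
        have hw : FunctionSpaces.Torus.IsContDiff 1 (fun x => v' t x - v t x) := ContDiff.sub hv't hvt
        have hsplit : v' t = v t + fun x => v' t x - v t x := by
          funext y; simp
        rw [hsplit, FunctionSpaces.Torus.partialDeriv_add hvt hw, Pi.add_apply]
        calc ‖FunctionSpaces.Torus.partialDeriv i (v t) x + FunctionSpaces.Torus.partialDeriv i (fun x => v' t x - v t x) x‖
            ≤ ‖FunctionSpaces.Torus.partialDeriv i (v t) x‖ + ‖FunctionSpaces.Torus.partialDeriv i (fun x => v' t x - v t x) x‖ :=
              norm_add_le _ _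
          _ ≤ M * ∑ j ∈ Finset.range (q + 1), Real.sqrt (amp a b j) * Λ j + M * Real.sqrt (amp a b (q + 1)) * Λ (q + 1) :=
              add_le_add (hder i t ht x) (O.incr_deriv i t ht x)
          _ = M * ∑ j ∈ Finset.range (q + 1 + 1), Real.sqrt (amp a b j) * Λ j := by
              rw [Finset.sum_range_succ _ (q + 1)]; ring
      -- cumulative pressure bounds
      have hpsup' : BDSV.SupLE T₀ (S e (q + 1)).2.1 (M ^ 2 * ∑ j ∈ Finset.range (q + 1), amp a b (j + 1)) := by
        intro t ht x
        rw [hS1]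
        calc ‖Φp e q (S e q).1 (S e q).2.1 (S e q).2.2 t x‖
            ≤ ‖(S e q).2.1 t x‖ + ‖Φp e q (S e q).1 (S e q).2.1 (S e q).2.2 t x - (S e q).2.1 t x‖ := norm_le_insert' _ _
          _ ≤ M ^ 2 * ∑ j ∈ Finset.range q, amp a b (j + 1) + M ^ 2 * amp a b (q + 1) :=
              add_le_add (hpsup t ht x) (O.pressure_incr_sup t ht x)
          _ = M ^ 2 * ∑ j ∈ Finset.range (q + 1), amp a b (j + 1) := by
              rw [Finset.sum_range_succ]; ring
      have hpder' : BDSV.DerivSupLE T₀ (S e (q + 1)).2.1 (M ^ 2 * ∑ j ∈ Finset.range (q + 1), amp a b (j + 1) * Λ (j + 1)) := by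
        intro i t ht x
        rw [hS1]
        dsimp only
        set pq := (S e q).2.1 with hpq_def
        set p' := Φp e q (S e q).1 pq (S e q).2.2 with hp'_def
        have hpt : FunctionSpaces.Torus.IsContDiff 1 (pq t) :=
          (hSt.solves.smooth_pressure.isSmooth_slice ht).isContDiff (by simp)
        have hp't : FunctionSpaces.Torus.IsContDiff 1 (p' t) :=
          (O.solves.smooth_pressure.isSmooth_slice ht).isContDiff (by simp)
        have hw : FunctionSpaces.Torus.IsContDiff 1 (fun x => p' t x - pq t x) := ContDiff.sub hp't hpt
        have hsplit : p' t = pq t + fun x => p' t x - pq t x := by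
          funext y; simp
        rw [hsplit, FunctionSpaces.Torus.partialDeriv_add hpt hw, Pi.add_apply]
        calc ‖FunctionSpaces.Torus.partialDeriv i (pq t) x + FunctionSpaces.Torus.partialDeriv i (fun x => p' t x - pq t x) x‖
            ≤ ‖FunctionSpaces.Torus.partialDeriv i (pq t) x‖ + ‖FunctionSpaces.Torus.partialDeriv i (fun x => p' t x - pq t x) x‖ :=
              norm_add_le _ _
          _ ≤ M ^ 2 * ∑ j ∈ Finset.range q, amp a b (j + 1) * Λ (j + 1) + M ^ 2 * amp a b (q + 1) * Λ (q + 1) :=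
              add_le_add (hpder i t ht x) (O.pressure_incr_deriv i t ht x)
          _ = M ^ 2 * ∑ j ∈ Finset.range (q + 1), amp a b (j + 1) * Λ (j + 1) := by
              rw [Finset.sum_range_succ]; ring
      refine ⟨?_, hsup', hder', hpsup', hpder'⟩
      -- the working hypotheses at stage `q + 1`
      have hsum1 : ∑ j ∈ Finset.range (q + 1), Real.sqrt (amp a b (j + 1)) ≤ 1 / 2 := sum_sqrt_amp_succ_le hb h9 (q + 1)
      have hsum2 : ∑ j ∈ Finset.range (q + 1 + 1), Real.sqrt (amp a b j) * Λ j ≤ 2 * (Real.sqrt (amp a b (q + 1)) * Λ (q + 1)) :=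
        sum_sqrt_amp_mul_le hb (by nlinarith [mul_pos (by linarith : (0:ℝ) < c) (by linarith : (0:ℝ) < b)]) h9 hΛ (q + 1)
      have hsum3 : ∑ j ∈ Finset.range (q + 1), amp a b (j + 1) ≤ 1 / 2 :=
        (Finset.sum_le_sum fun j _ => amp_le_sqrt_amp (hamp0 (j + 1)).le (hamp1 (j + 1))).trans hsum1
      have hsum4 : ∑ j ∈ Finset.range (q + 1), amp a b (j + 1) * Λ (j + 1) ≤ 2 * (amp a b (q + 1) * Λ (q + 1)) := by
        have h := sum_amp_mul_le hb (by nlinarith [mul_pos (by linarith : (0:ℝ) < c) (by linarith : (0:ℝ) < b)]) h9 hΛ (q + 1)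
        have h' : ∑ j ∈ Finset.range (q + 1), amp a b (j + 1) * Λ (j + 1) ≤
            ∑ j ∈ Finset.range (q + 1 + 1), amp a b j * Λ j := by
          rw [Finset.sum_range_succ' (fun j => amp a b j * (Λ j : ℝ)) (q + 1)]
          have : 0 ≤ amp a b 0 * (Λ 0 : ℝ) := mul_nonneg (hamp0 0).le (hΛ0 0)
          linarith
        exact h'.trans h
      refine ⟨by rw [hS1]; exact O.solves, by rw [hS1]; exact O.traceFree, ?_, ?_, by rw [hS1]; exact O.stress_sup,
        by rw [hS1]; exact O.stress_deriv, ?_, ?_, ?_, by rw [hS1]; exact O.energy⟩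
      · intro t ht x
        refine (hsup' t ht x).trans ?_
        calc M * (1 + ∑ j ∈ Finset.range (q + 1), Real.sqrt (amp a b (j + 1))) ≤ M * (1 + 1 / 2) := by gcongr
          _ ≤ 2 * M := by linarith
      · intro i t ht x
        refine (hder' i t ht x).trans ?_
        calc M * ∑ j ∈ Finset.range (q + 1 + 1), Real.sqrt (amp a b j) * Λ j ≤ M * (2 * (Real.sqrt (amp a b (q + 1)) * Λ (q + 1))) :=
              mul_le_mul_of_nonneg_left hsum2 hM0.le
          _ = 2 * M * Real.sqrt (amp a b (q + 1)) * Λ (q + 1) := by ring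
      · intro t ht x
        refine (hpsup' t ht x).trans ?_
        have hM2 : 0 ≤ M ^ 2 := sq_nonneg M
        calc M ^ 2 * ∑ j ∈ Finset.range (q + 1), amp a b (j + 1) ≤ M ^ 2 * (1 / 2) :=
              mul_le_mul_of_nonneg_left hsum3 hM2
          _ ≤ 2 * M ^ 2 := by nlinarith
      · intro i t ht x
        refine (hpder' i t ht x).trans ?_
        calc M ^ 2 * ∑ j ∈ Finset.range (q + 1), amp a b (j + 1) * Λ (j + 1) ≤ M ^ 2 * (2 * (amp a b (q + 1) * Λ (q + 1))) :=
              mul_le_mul_of_nonneg_left hsum4 (sq_nonneg M)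
          _ = 2 * M ^ 2 * amp a b (q + 1) * Λ (q + 1) := by ring
      · intro t ht x
        rw [hS1]
        refine (O.transport t ht x).trans ?_
        have h0 : 0 ≤ amp a b (q + 2) * Real.sqrt (amp a b (q + 1)) * Λ (q + 1) :=
          mul_nonneg (mul_nonneg (hamp0 (q + 2)).le (Real.sqrt_nonneg _)) (hΛ0 (q + 1))
        calc amp a b (q + 2) * Real.sqrt (amp a b (q + 1)) * Λ (q + 1)
            = 1 * (amp a b (q + 2) * Real.sqrt (amp a b (q + 1)) * Λ (q + 1)) := (one_mul _).symm
          _ ≤ M * (amp a b (q + 2) * Real.sqrt (amp a b (q + 1)) * Λ (q + 1)) := mul_le_mul_of_nonneg_right hM h0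
          _ = M * amp a b (q + 1 + 1) * Real.sqrt (amp a b (q + 1)) * Λ (q + 1) := by ring
  refine ⟨Λ, fun e q => (S e q).1, fun e q => (S e q).2.1, fun e q => (S e q).2.2, hΛ, ?_, ?_⟩
  · -- the iteration sequence for `e ∈ 𝓔`
    intro e he
    have P : StartProfile c₀ T₀ E₁ E₂ e := h𝓔.startProfile he
    have Pe : IsEnergyProfile c₀ T₀ E₁ e := h𝓔.isEnergyProfile he
    obtain ⟨hn1, L26, L31, L32, L33, L37, L38a, L38b, L35⟩ := ColomboDeLellisDeRosa2018_lem31 H hlam P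
    have O : ∀ q, IsStepOutput α T₀ M η a b Λ e q (S e q).1 (S e q).2.1 (S e (q + 1)).1 (S e (q + 1)).2.1 (S e (q + 1)).2.2 :=
      fun q => by
        rw [hS1]
        exact hout E₁ e q (S e q).1 (S e q).2.1 (S e q).2.2 hE₁1 hC₁E₁ Pe (key e he q).1
    exact
      { isFracNSReynoldsOn := fun q => (key e he q).1.solves
        velocity_sup := fun q => (O q).incr_sup
        velocity_deriv := fun q => (O q).incr_deriv
        pressure_sup := fun q => (O q).pressure_incr_sup
        stress_sup := fun q => (key e he q).1.stress_sup
        energy := fun q => (key e he q).1.energy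
        velocity_zero_sup := L37
        velocity_zero_deriv := by
          intro i t ht x
          refine (L38a i t ht x).trans (mul_le_mul_of_nonneg_right (le_max_left _ _) ?_)
          exact le_max_of_le_left (Real.rpow_nonneg ha0.le _) }
  · -- the common initial slices
    have hzero : ∀ q, ∀ e₁ ∈ 𝓔, ∀ e₂ ∈ 𝓔, (S e₁ q).1 0 = (S e₂ q).1 0 ∧ (S e₁ q).2.2 0 = (S e₂ q).2.2 0 := by
      intro q
      induction q with
      | zero =>
        intro e₁ he₁ e₂ he₂
        have h0 : e₁ 0 = e₂ 0 := h𝓔.apply_zero_eq e₁ he₁ e₂ he₂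
        have h1 : deriv e₁ 0 = deriv e₂ 0 := h𝓔.deriv_zero_eq e₁ he₁ e₂ he₂
        have hlo : c₀ / 4 < e₁ 0 := by
          have := h𝓔.lower e₁ he₁ 0 ⟨le_rfl, hT₀.le⟩
          linarith
        refine ⟨?_, ?_⟩
        · simp only [hS0, hstart_def]
          exact shearVelocity_startAmp_zero_eq h0 n _
        · simp only [hS0, hstart_def]
          exact shearStress_startAmp_zero_eq ((h𝓔.contDiff e₁ he₁).differentiable (by simp))
            ((h𝓔.contDiff e₂ he₂).differentiable (by simp)) hamp1lt hc₀.le hlo h0 h1 α n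
      | succ q ih =>
        intro e₁ he₁ e₂ he₂
        obtain ⟨hv, hR⟩ := ih e₁ he₁ e₂ he₂
        have h0 : e₁ 0 = e₂ 0 := h𝓔.apply_zero_eq e₁ he₁ e₂ he₂
        rw [hS1, hS1]
        exact hloc E₁ E₁ e₁ e₂ q _ _ _ _ _ _ hE₁1 hC₁E₁ (h𝓔.isEnergyProfile he₁) (key e₁ he₁ q).1
          hE₁1 hC₁E₁ (h𝓔.isEnergyProfile he₂) (key e₂ he₂ q).1 h0 hv hR
    intro e₁ he₁ e₂ he₂ q
    exact (hzero q e₁ he₁ e₂ he₂).1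

end Assembly

end CDLDR

end Literature.Analysis.FluidPDE
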